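import Mathlib
import HarnessLib
import Summits.NavierStokesRegularity.NavierStokesRegularity.Theorems.PoloidalWindowRigidity.Negative.TriWaveProfile

/-!
# Crux K2 `PoloidalWindowRigidity` (stmt-NavierStokesRegularity-19708), line `z_shock` — TIGHTNESS of the kernel reduction of the
# deciding stub: the genuinely-nonlinear point of `hGN` is load-bearing, and the constant-slope residue `hTV₀` is kinematically INHABITED
# (with twist) by the tree's three-wave field

`--supports stmt-NavierStokesRegularity-19708 --as helper` (leafhand-ns-poloidalwindowdoor-3 g12, cell decomp-ns, 2026-08-31).  Def-free;
tree files only (the refuter's three-wave field `…PoloidalWindowRigidity.Negative.triField`,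
`T = (2cos(x₀+x₂), 2cos(x₁−x₂) + 2cos(x₁+x₂), −2cos(x₀+x₂) + 2cos(x₁−x₂) − 2cos(x₁+x₂))`).
**No stub and no summit is closed by this file; Navier–Stokes regularity is NOT proved here (rung 0).**

`…ZShockAutReduction` / `…ZShockThInstantSlope` (p835195 / p835270) derive the registered type of `stub_zShockThickAut` from
`hGN` (class-free slice Liouville statement with a genuinely nonlinear point) and `hTV₀` (the stub on a slice with a GLOBAL constant
negative slope law).  This file records, in the kernel, that the split is honest:
* `triField_constSlope` — `T` obeys the GLOBAL constant slope law `∂₂T_b = (−1)·∂_bT₂`, `b = 0, 1` (it is `(∇ₕφ, −∂₂φ)` for three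
  solutions `φ` of `∂₂²φ = Δₕφ`): so its genuine-nonlinearity defects and autonomy minors vanish and its hyperbolicity discriminant is
  `−|∇ₕT₂|² ≤ 0`;
* `analyticOnNhd_triField`, `triField_twist_at`, `triField_hyperbolic_at` — `T` is entire real-analytic, TWISTING
  (`∇ₕ(∂₂T₂) ∧ ∇ₕT₂ = −8` at `(π/2, 0, 0)`) and strictly hyperbolic there (`E = −4`);
* ★ `sliceLiouville_false_without_gn` — the hypothesis `hGN` of the reduction WITH ITS GENUINELY-NONLINEAR CLAUSE DELETED is FALSE:
  `T` is analytic, bounded (`‖T‖ ≤ 12`), has bounded gradient (`‖DT‖ ≤ 24`), is divergence-free, poloidal along `e₃`, satisfies the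
  wedge law, the autonomy minors, `E ≤ 0` everywhere, and has a strictly hyperbolic and a twisting point — yet exists.  So the
  kinematic lever of line `z_shock` needs genuine nonlinearity (THICK) exactly as the card says, now for the class-free slice statement
  with twist (the tree's earlier tightness facts `rotating_const_false_without_thick` / `linear_rotating_slice_inhabitant` are at the
  level of the scalar slice equation);
* `constSlope_slice_inhabited` — the slice clause of the residue `hTV₀` (global constant slope `c = −1 < 0`, twisting, strictly
  hyperbolic, analytic, bounded, divergence-free, poloidal) is inhabited: closing `hTV₀` must use the Navier–Stokes dynamics in time
  (the (TH) column), not slice kinematics.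
HONEST LABEL: tightness bookkeeping for a reduction; closes nothing. [folklore]
-/

noncomputable section

namespace Summit.NavierStokesRegularity.NavierStokesRegularity.Theorems.PoloidalWindowDoorPoloidalWindowRigidityZShockAutReductionTight

-- the problem directory repeats the summit name (`NavierStokesRegularity/NavierStokesRegularity`)
set_option linter.dupNamespace false

open Set Function
open scoped RealInnerProductSpace InnerProductSpace
open Literature.Analysis Literature.Analysis.FluidPDE
open Summit.NavierStokesRegularity.NavierStokesRegularity.Theorems.PoloidalWindowRigidity.Negative

/-! ## The three-wave field has constant slope `−1` -/

/-- **Global constant slope law of the three-wave field**: `∂₂T_b = (−1)·∂_bT₂` on `ℝ³`, `b = 0, 1`. [folklore] -/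
theorem triField_constSlope (y : EuclideanSpace ℝ (Fin 3)) (b : Fin 3) (hb : b ≠ 2) :
    fderiv ℝ triField y (EuclideanSpace.single 2 1) b = (-1) * fderiv ℝ triField y (EuclideanSpace.single b 1) 2 := by
  rw [fderiv_triField]
  fin_cases b
  · simp [triDeriv_apply_zero, triDeriv_apply_two]
  · simp [triDeriv_apply_one, triDeriv_apply_two]; ring
  · exact absurd rfl hb

/-- The horizontal derivative `∂₀T₂ = 2 sin(x₀ + x₂)`. [folklore] -/
theorem triField_d0_two (y : EuclideanSpace ℝ (Fin 3)) :
    fderiv ℝ triField y (EuclideanSpace.single 0 1) 2 = 2 * Real.sin (y 0 + y 2) := by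
  rw [fderiv_triField, triDeriv_apply_two]; simp

/-- The horizontal derivative `∂₁T₂ = −2 sin(x₁ − x₂) + 2 sin(x₁ + x₂)`. [folklore] -/
theorem triField_d1_two (y : EuclideanSpace ℝ (Fin 3)) :
    fderiv ℝ triField y (EuclideanSpace.single 1 1) 2 = -2 * Real.sin (y 1 - y 2) + 2 * Real.sin (y 1 + y 2) := by
  rw [fderiv_triField, triDeriv_apply_two]; simp

/-- The vertical derivative `∂₂T₂ = 2 sin(x₀+x₂) + 2 sin(x₁−x₂) + 2 sin(x₁+x₂)` as a function. [folklore] -/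
theorem triField_d2_two_eq :
    (fun x : EuclideanSpace ℝ (Fin 3) => fderiv ℝ triField x (EuclideanSpace.single 2 1) 2) =
      fun x => 2 * Real.sin (x 0 + x 2) + 2 * Real.sin (x 1 - x 2) + 2 * Real.sin (x 1 + x 2) := by
  funext x
  rw [fderiv_triField, triDeriv_apply_two]; simp

/-- The derivative of `∂₂T₂` (explicit continuous linear map). [folklore] -/
theorem hasFDerivAt_triField_d2_two (x : EuclideanSpace ℝ (Fin 3)) :
    HasFDerivAt (fun x : EuclideanSpace ℝ (Fin 3) => fderiv ℝ triField x (EuclideanSpace.single 2 1) 2)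
      ((2 * Real.cos (x 0 + x 2)) • ((EuclideanSpace.proj (𝕜 := ℝ) (0 : Fin 3) : EuclideanSpace ℝ (Fin 3) →L[ℝ] ℝ) +
          (EuclideanSpace.proj (𝕜 := ℝ) (2 : Fin 3) : EuclideanSpace ℝ (Fin 3) →L[ℝ] ℝ)) +
        (2 * Real.cos (x 1 - x 2)) • ((EuclideanSpace.proj (𝕜 := ℝ) (1 : Fin 3) : EuclideanSpace ℝ (Fin 3) →L[ℝ] ℝ) -
          (EuclideanSpace.proj (𝕜 := ℝ) (2 : Fin 3) : EuclideanSpace ℝ (Fin 3) →L[ℝ] ℝ)) +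
        (2 * Real.cos (x 1 + x 2)) • ((EuclideanSpace.proj (𝕜 := ℝ) (1 : Fin 3) : EuclideanSpace ℝ (Fin 3) →L[ℝ] ℝ) +
          (EuclideanSpace.proj (𝕜 := ℝ) (2 : Fin 3) : EuclideanSpace ℝ (Fin 3) →L[ℝ] ℝ))) x := by
  rw [triField_d2_two_eq]
  have h0 : HasFDerivAt (fun y : EuclideanSpace ℝ (Fin 3) => y 0)
      (EuclideanSpace.proj (𝕜 := ℝ) (0 : Fin 3) : EuclideanSpace ℝ (Fin 3) →L[ℝ] ℝ) x :=
    (EuclideanSpace.proj (𝕜 := ℝ) (0 : Fin 3) : EuclideanSpace ℝ (Fin 3) →L[ℝ] ℝ).hasFDerivAt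
  have h1 : HasFDerivAt (fun y : EuclideanSpace ℝ (Fin 3) => y 1)
      (EuclideanSpace.proj (𝕜 := ℝ) (1 : Fin 3) : EuclideanSpace ℝ (Fin 3) →L[ℝ] ℝ) x :=
    (EuclideanSpace.proj (𝕜 := ℝ) (1 : Fin 3) : EuclideanSpace ℝ (Fin 3) →L[ℝ] ℝ).hasFDerivAt
  have h2 : HasFDerivAt (fun y : EuclideanSpace ℝ (Fin 3) => y 2)
      (EuclideanSpace.proj (𝕜 := ℝ) (2 : Fin 3) : EuclideanSpace ℝ (Fin 3) →L[ℝ] ℝ) x :=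
    (EuclideanSpace.proj (𝕜 := ℝ) (2 : Fin 3) : EuclideanSpace ℝ (Fin 3) →L[ℝ] ℝ).hasFDerivAt
  have hu := (Real.hasDerivAt_sin (x 0 + x 2)).comp_hasFDerivAt x (h0.add h2)
  have hw := (Real.hasDerivAt_sin (x 1 - x 2)).comp_hasFDerivAt x (h1.sub h2)
  have hp := (Real.hasDerivAt_sin (x 1 + x 2)).comp_hasFDerivAt x (h1.add h2)
  have H := ((hu.const_mul (2 : ℝ)).add (hw.const_mul (2 : ℝ))).add (hp.const_mul (2 : ℝ))
  refine H.congr_fderiv ?_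
  simp only [smul_smul]

/-- **Twist of the three-wave field at `(π/2, 0, 0)`**: `∂₀(∂₂T₂)·∂₁T₂ − ∂₁(∂₂T₂)·∂₀T₂ = −8 ≠ 0`. [folklore] -/
theorem triField_twist_at :
    fderiv ℝ (fun x => fderiv ℝ triField x (EuclideanSpace.single 2 1) 2)
          (EuclideanSpace.single 0 (Real.pi / 2)) (EuclideanSpace.single 0 1) *
        fderiv ℝ triField (EuclideanSpace.single 0 (Real.pi / 2)) (EuclideanSpace.single 1 1) 2 -
      fderiv ℝ (fun x => fderiv ℝ triField x (EuclideanSpace.single 2 1) 2)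
          (EuclideanSpace.single 0 (Real.pi / 2)) (EuclideanSpace.single 1 1) *
        fderiv ℝ triField (EuclideanSpace.single 0 (Real.pi / 2)) (EuclideanSpace.single 0 1) 2 ≠ 0 := by
  rw [(hasFDerivAt_triField_d2_two _).fderiv, triField_d0_two, triField_d1_two]
  simp

/-- **Strict hyperbolicity of the three-wave field at `(π/2, 0, 0)`**: `E = ∂₂T₀∂₀T₂ + ∂₂T₁∂₁T₂ = −4 < 0`. [folklore] -/
theorem triField_hyperbolic_at :
    fderiv ℝ triField (EuclideanSpace.single 0 (Real.pi / 2)) (EuclideanSpace.single 2 1) 0 *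
        fderiv ℝ triField (EuclideanSpace.single 0 (Real.pi / 2)) (EuclideanSpace.single 0 1) 2 +
      fderiv ℝ triField (EuclideanSpace.single 0 (Real.pi / 2)) (EuclideanSpace.single 2 1) 1 *
        fderiv ℝ triField (EuclideanSpace.single 0 (Real.pi / 2)) (EuclideanSpace.single 1 1) 2 < 0 := by
  rw [triField_constSlope _ 0 (by decide), triField_constSlope _ 1 (by decide), triField_d0_two, triField_d1_two]
  simp

/-- The three-wave field is entire real-analytic. [folklore] -/
theorem analyticOnNhd_triField : AnalyticOnNhd ℝ triField univ := by
  intro x _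
  have hY : ∀ k : Fin 3, AnalyticAt ℝ (fun y : EuclideanSpace ℝ (Fin 3) => y k) x := fun k =>
    (EuclideanSpace.proj (𝕜 := ℝ) k : EuclideanSpace ℝ (Fin 3) →L[ℝ] ℝ).analyticAt x
  have hu : AnalyticAt ℝ (fun y : EuclideanSpace ℝ (Fin 3) => Real.cos (y 0 + y 2)) x :=
    (Real.analyticAt_cos.comp ((hY 0).add (hY 2)) :)
  have hw : AnalyticAt ℝ (fun y : EuclideanSpace ℝ (Fin 3) => Real.cos (y 1 - y 2)) x :=
    (Real.analyticAt_cos.comp ((hY 1).sub (hY 2)) :)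
  have hp : AnalyticAt ℝ (fun y : EuclideanSpace ℝ (Fin 3) => Real.cos (y 1 + y 2)) x :=
    (Real.analyticAt_cos.comp ((hY 1).add (hY 2)) :)
  have e : triField = fun x : EuclideanSpace ℝ (Fin 3) =>
      (2 * Real.cos (x 0 + x 2)) • (EuclideanSpace.single (0 : Fin 3) (1 : ℝ)) +
        (2 * Real.cos (x 1 - x 2) + 2 * Real.cos (x 1 + x 2)) • (EuclideanSpace.single (1 : Fin 3) (1 : ℝ)) +
        (-(2 * Real.cos (x 0 + x 2)) + 2 * Real.cos (x 1 - x 2) - 2 * Real.cos (x 1 + x 2)) •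
          (EuclideanSpace.single (2 : Fin 3) (1 : ℝ)) := by
    funext x; rfl
  rw [e]
  exact (((analyticAt_const.mul hu).smul analyticAt_const).add
    (((analyticAt_const.mul hw).add (analyticAt_const.mul hp)).smul analyticAt_const)).add
    ((((analyticAt_const.mul hu).neg.add (analyticAt_const.mul hw)).sub (analyticAt_const.mul hp)).smul analyticAt_const)

/-- The three-wave field is divergence-free (slice `t = −1` of the tree's profile). [folklore] -/
theorem isDivFree_triField : VectorCalculus.IsDivFree triField := by
  have h := isDivFree_triProfile (-1)
  rwa [triProfile_neg_one] at h

/-- The three-wave field is poloidal along `e₃`. [folklore] -/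
theorem poloidal_triField (y : EuclideanSpace ℝ (Fin 3)) :
    ⟪curl triField y, EuclideanSpace.single 2 1⟫_ℝ = 0 := by
  have h := poloidal_triProfile (-1) y
  rwa [triProfile_neg_one] at h

/-! ## Tightness of the reduction -/

/-- ★ **`hGN` without its genuinely-nonlinear clause is FALSE.**  The class-free slice Liouville hypothesis of
`…ZShockAutReduction.stub_zShockThickAut_of_sliceLiouville_of_thInstant` with the last clause («a genuinely nonlinear point») deleted —
everything else VERBATIM — fails: the three-wave field satisfies all remaining hypotheses. [folklore] -/
theorem sliceLiouville_false_without_gn :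
    ¬ (∀ (u : EuclideanSpace ℝ (Fin 3) → EuclideanSpace ℝ (Fin 3)),
      AnalyticOnNhd ℝ u Set.univ →
      (∃ M : ℝ, ∀ x, ‖u x‖ ≤ M) →
      (∃ M₁ : ℝ, ∀ x, ‖fderiv ℝ u x‖ ≤ M₁) →
      Literature.Analysis.FluidPDE.VectorCalculus.IsDivFree u →
      (∀ y, ⟪Literature.Analysis.FluidPDE.curl u y, EuclideanSpace.single 2 1⟫_ℝ = 0) →
      (∀ y, fderiv ℝ u y (EuclideanSpace.single 2 1) 0 * fderiv ℝ u y (EuclideanSpace.single 1 1) 2 -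
        fderiv ℝ u y (EuclideanSpace.single 2 1) 1 * fderiv ℝ u y (EuclideanSpace.single 0 1) 2 = 0) →
      (∀ b : Fin 3, b ≠ 2 → ∀ x p q : EuclideanSpace ℝ (Fin 3),
        (fderiv ℝ u x (EuclideanSpace.single b 1) 2 *
              fderiv ℝ (fun y => fderiv ℝ u y (EuclideanSpace.single 2 1) b) x p -
            fderiv ℝ u x (EuclideanSpace.single 2 1) b *
              fderiv ℝ (fun y => fderiv ℝ u y (EuclideanSpace.single b 1) 2) x p) *
            fderiv ℝ (fun y => u y 2) x q -
          (fderiv ℝ u x (EuclideanSpace.single b 1) 2 *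
              fderiv ℝ (fun y => fderiv ℝ u y (EuclideanSpace.single 2 1) b) x q -
            fderiv ℝ u x (EuclideanSpace.single 2 1) b *
              fderiv ℝ (fun y => fderiv ℝ u y (EuclideanSpace.single b 1) 2) x q) *
            fderiv ℝ (fun y => u y 2) x p = 0) →
      (∀ y, fderiv ℝ u y (EuclideanSpace.single 2 1) 0 * fderiv ℝ u y (EuclideanSpace.single 0 1) 2 +
        fderiv ℝ u y (EuclideanSpace.single 2 1) 1 * fderiv ℝ u y (EuclideanSpace.single 1 1) 2 ≤ 0) →
      (∃ y, fderiv ℝ u y (EuclideanSpace.single 2 1) 0 * fderiv ℝ u y (EuclideanSpace.single 0 1) 2 +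
        fderiv ℝ u y (EuclideanSpace.single 2 1) 1 * fderiv ℝ u y (EuclideanSpace.single 1 1) 2 < 0) →
      (∃ y, fderiv ℝ (fun x => fderiv ℝ u x (EuclideanSpace.single 2 1) 2) y (EuclideanSpace.single 0 1) *
            fderiv ℝ u y (EuclideanSpace.single 1 1) 2 -
          fderiv ℝ (fun x => fderiv ℝ u x (EuclideanSpace.single 2 1) 2) y (EuclideanSpace.single 1 1) *
            fderiv ℝ u y (EuclideanSpace.single 0 1) 2 ≠ 0) →
      False) := by
  intro h
  refine h triField analyticOnNhd_triField ⟨12, norm_triField_le⟩ ?_ isDivFree_triField poloidal_triField ?_ ?_ ?_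
    ⟨_, triField_hyperbolic_at⟩ ⟨_, triField_twist_at⟩
  · -- bounded gradient
    refine ⟨24, fun x => ?_⟩
    rw [fderiv_triField]
    exact ContinuousLinearMap.opNorm_le_bound _ (by norm_num) (norm_triDeriv_apply_le x)
  · -- wedge law from the constant slope
    intro y
    rw [triField_constSlope y 0 (by decide), triField_constSlope y 1 (by decide)]
    ring
  · -- autonomy minors from the constant slope (as a function identity)
    intro b hb x p q
    have hfun : (fun y => fderiv ℝ triField y (EuclideanSpace.single 2 1) b) =
        fun y => -fderiv ℝ triField y (EuclideanSpace.single b 1) 2 := by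
      funext y; rw [triField_constSlope y b hb]; ring
    rw [hfun, fderiv_fun_neg, triField_constSlope x b hb]
    have hn : ∀ r : EuclideanSpace ℝ (Fin 3),
        (-fderiv ℝ (fun y => fderiv ℝ triField y (EuclideanSpace.single b 1) 2) x) r =
          -(fderiv ℝ (fun y => fderiv ℝ triField y (EuclideanSpace.single b 1) 2) x r) := fun r => rfl
    rw [hn p, hn q]
    ring
  · -- no strictly elliptic point
    intro y
    rw [triField_constSlope y 0 (by decide), triField_constSlope y 1 (by decide)]
    nlinarith [sq_nonneg (fderiv ℝ triField y (EuclideanSpace.single 0 1) 2),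
      sq_nonneg (fderiv ℝ triField y (EuclideanSpace.single 1 1) 2)]

/-- **The slice clause of the residue `hTV₀` is inhabited (with twist).**  There is an entire real-analytic, bounded, divergence-free
field on `ℝ³`, poloidal along `e₃`, with bounded gradient, a GLOBAL constant negative slope law `∂₂u_b = c·∂_b u₂` (`c = −1`), a
strictly hyperbolic point and a twisting point — the three-wave field.  So the (TV)-instant residue of the deciding stub cannot be
closed by slice kinematics. [folklore] -/
theorem constSlope_slice_inhabited :
    ∃ u : EuclideanSpace ℝ (Fin 3) → EuclideanSpace ℝ (Fin 3),
      AnalyticOnNhd ℝ u Set.univ ∧ (∃ M : ℝ, ∀ x, ‖u x‖ ≤ M) ∧ (∃ M₁ : ℝ, ∀ x, ‖fderiv ℝ u x‖ ≤ M₁) ∧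
      Literature.Analysis.FluidPDE.VectorCalculus.IsDivFree u ∧
      (∀ y, ⟪Literature.Analysis.FluidPDE.curl u y, EuclideanSpace.single 2 1⟫_ℝ = 0) ∧
      (∃ c : ℝ, c < 0 ∧ ∀ y, ∀ b : Fin 3, b ≠ 2 →
        fderiv ℝ u y (EuclideanSpace.single 2 1) b = c * fderiv ℝ u y (EuclideanSpace.single b 1) 2) ∧
      (∃ y, fderiv ℝ u y (EuclideanSpace.single 2 1) 0 * fderiv ℝ u y (EuclideanSpace.single 0 1) 2 +
        fderiv ℝ u y (EuclideanSpace.single 2 1) 1 * fderiv ℝ u y (EuclideanSpace.single 1 1) 2 < 0) ∧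
      (∃ y, fderiv ℝ (fun x => fderiv ℝ u x (EuclideanSpace.single 2 1) 2) y (EuclideanSpace.single 0 1) *
            fderiv ℝ u y (EuclideanSpace.single 1 1) 2 -
          fderiv ℝ (fun x => fderiv ℝ u x (EuclideanSpace.single 2 1) 2) y (EuclideanSpace.single 1 1) *
            fderiv ℝ u y (EuclideanSpace.single 0 1) 2 ≠ 0) := by
  refine ⟨triField, analyticOnNhd_triField, ⟨12, norm_triField_le⟩, ⟨24, fun x => ?_⟩, isDivFree_triField,
    poloidal_triField, ⟨-1, by norm_num, triField_constSlope⟩, ⟨_, triField_hyperbolic_at⟩, ⟨_, triField_twist_at⟩⟩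
  rw [fderiv_triField]
  exact ContinuousLinearMap.opNorm_le_bound _ (by norm_num) (norm_triDeriv_apply_le x)

end Summit.NavierStokesRegularity.NavierStokesRegularity.Theorems.PoloidalWindowDoorPoloidalWindowRigidityZShockAutReductionTight
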